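import Literature.MathematicalPhysics.QuantumFieldTheory.Balaban1983to89.Node00.BackgroundActionOfRecord
import Literature.MathematicalPhysics.QuantumFieldTheory.Balaban1983to89.Node00.SmallFieldChiOfRecord

/-!
# NODE 00 — DEFINER ₇, FILE 3: (§1) the small-field domain of [I] p. 259, FIRST printed form, over the ONE global background
# `U_k(V)` of record (node00-def-B's `Node00.Uk`, [I] (0.21) ∕ (1.1)–(1.2)); (§2) `E` of record in NORMALISATION-CONSTANT form
# `Σ_{j<K} log 𝐍_j` over node00-def-B's `normConstOfRecord` ([I] (0.19), [III] Thm 1 p. 262), bridged to FILE 1's (1.15)-split form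

Seat `pub-ymgap-node00-def-R` (DEFINER ₇).  [I] = [Balaban1987RG1].  Coordination of record: pub-ymgap INBOX
[NODE00-DEF-B-G0-COORD-DEF-R-1] l.9473 ∕ [NODE00-DEF-R-G0-COORD-DEF-B-1] l.9492 — `dom`, `wilsonBG` and (via the merged terms) `βfun`
all read ONE `U_k`; this file therefore imports `Node00/BackgroundActionOfRecord.lean` and defines only the domain.

[I] p. 259, verbatim: *"For the k-th action such a domain is determined by the condition |∂U_k(V) − 1| < ε₀η² on T_η, for ε₀
sufficiently small.  Another possible definition, technically less convenient, is given by the condition |∂V − 1| < ε₀ on T₁^{(k)}."*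
The second form is `Node00.domAltOfRecord` (FILE 1); this is the first.  `U_k(V)` is TOTAL (junk = the unit configuration off
node00-def-B's solvable set `UkExists`), so the domain is a total `Set`; no relation between the two forms is asserted (print
asserts none beyond "another possible definition").  Nothing of Bałaban's is asserted.  No `instance`, no `notation`, no `sorry`.
§2 ([NODE00-DEF-B-G0-INTENT-1-ADDENDUM] l.9574): [III] Thm 1 p. 262 defines `E` as *"a sum of all such expressions for all the lattices"*, the
expression of step `j` being the constant produced by the normalised transformation — node00-def-B's `normConstOfRecord χ β p j`
= 𝐍_j of [I] (0.19) p. 255 (*"𝐍_k is given by the integral above with V = 1"*), an honest real number; `ENormOfRecord` is the sum of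
their logarithms, and `EOfRecord_eq_ENormOfRecord` records that FILE 1's parametric form IS this one once the fluctuation input `Efl`
is read as `log 𝐍_j −` (the three explicit (1.15) terms) — the (1.15) split of `log 𝐍_j` itself stays DISPLAYED (no carrier for
`z_j`, `E^{(j+1)}` separately; def-B's D-defB-2).  HONEST FRAMING: definitions of record + one algebraic identity; counts unmoved;
NOT continuum ∕ OS ∕ mass-gap ∕ Clay.
-/

noncomputable section

namespace Literature.MathematicalPhysics.QuantumFieldTheory.Balaban1983to89.Node00

open T4Continuum
open FlowStep (HBeta)
open FlowStepRuns (genSeq)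

variable (F : T4Family) (N : ℕ) [NeZero N]

/-! ## §1 The small-field domain, first printed form -/

/-- **The small-field domain of record, first printed form** — [I] p. 259: *"|∂U_k(V) − 1| < ε₀η² on T_η"*, with `U_k(V)` =
node00-def-B's global minimiser of record `Uk F N K k ν.εreg V` (regularity class `bgReg … k ν.εreg` = `{U | |U(∂p) − 1| <
εreg·η_k²}`) and `η = η_k = L^{−k}` (`Params.eta`). Fills `Residual₅.dom` (node00-def reads it at `K = p.K`). [cite: Balaban1987RG1, p.259] -/
def domOfRecord (ν : Stage7Numerics) (K k : ℕ) : Set (GaugeField (F.P K) k (SU N)) :=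
  {V | PlaqSmall (ν.ε₀ * (F.P K).eta k ^ 2) (Uk F N K k ν.εreg V)}

/-- Membership in the first-form domain. [cite: Balaban1987RG1, p.259 (bookkeeping)] -/
theorem mem_domOfRecord_iff (ν : Stage7Numerics) (K k : ℕ) (V : GaugeField (F.P K) k (SU N)) :
    V ∈ domOfRecord F N ν K k ↔ PlaqSmall (ν.ε₀ * (F.P K).eta k ^ 2) (Uk F N K k ν.εreg V) := Iff.rfl

/-- Off node00-def-B's solvable set the background is the unit configuration, all of whose plaquette variables are `1`; so for
`0 < ε₀` such a `V` lies in the first-form domain (the documented JUNK corner of the total definition — print's domain is meant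
on the solvable set only; node00-def's admissibility decides what is read there). [cite: Balaban1987RG1, p.259 (typing convention)] -/
theorem mem_domOfRecord_of_not_ukExists (ν : Stage7Numerics) (K k : ℕ)
    (V : GaugeField (F.P K) k (SU N)) (h : ¬ UkExists F N K k ν.εreg V) (hε : 0 < ν.ε₀ * (F.P K).eta k ^ 2) :
    V ∈ domOfRecord F N ν K k := by
  rw [mem_domOfRecord_iff, Uk_of_not h]
  intro q
  have hb : ∀ b, (1 : GaugeField (F.P K) 0 (SU N)) b = 1 := fun _ => rfl
  have h1 : GaugeField.plaqHol (1 : GaugeField (F.P K) 0 (SU N)) q = 1 := by simp [GaugeField.plaqHol, hb]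
  rw [h1, GaugeGroup.dist1_one]
  exact hε

/-! ## §2 `E` of record, normalisation-constant form -/

/-- **`E` OF RECORD, NORMALISATION-CONSTANT FORM** — `Σ_{j<K} log 𝐍_j` for the run `p`, `𝐍_j = normConstOfRecord χ β p j`
(node00-def-B; [I] (0.19)).  [III] Thm 1 p. 262: *"This initial constant is defined in fact as a sum of all such expressions for
all the lattices"*.  Total (Mathlib's `Real.log` is total); meaningful where the `𝐍_j` are positive (def-B's
`normConstH_mul_exp_effActionH_succ` hypothesis). [cite: Balaban1988Convergent, Thm 1 p.262] -/
def ENormOfRecord (χ : (K : ℕ) → (ℕ → ℝ) → (k : ℕ) → Density (F.P K) k (SU N)) (β : HBeta) (p : B12.RunParams) : ℝ :=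
  ∑ j ∈ Finset.range p.K, Real.log (normConstOfRecord F N χ β p j)

/-- Unfolding. [cite: Balaban1988Convergent, Thm 1 p.262 (bookkeeping)] -/
theorem ENormOfRecord_eq (χ : (K : ℕ) → (ℕ → ℝ) → (k : ℕ) → Density (F.P K) k (SU N)) (β : HBeta) (p : B12.RunParams) :
    ENormOfRecord F N χ β p = ∑ j ∈ Finset.range p.K, Real.log (normConstOfRecord F N χ β p j) := rfl

/-- **BRIDGE between the two forms of `E` of record**: reading FILE 1's fluctuation input as `Efl p j := log 𝐍_j − (d(𝔤) log g_j
|T^{(j)*}| + log σ₀ |T^{(j)*}| − log z_j (L⁴ − 1)|T₁^{(j+1)}|)` — the [III] (1.15) p. 249 split of `log 𝐍_j`, DISPLAYED — the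
parametric `EOfRecord` equals `ENormOfRecord` identically (so `logz` is bookkeeping there). [cite: Balaban1988Convergent, (1.15) p.249; Thm 1 p.262 (bookkeeping)] -/
theorem EOfRecord_eq_ENormOfRecord (ν : Stage7Numerics) (χ : (K : ℕ) → (ℕ → ℝ) → (k : ℕ) → Density (F.P K) k (SU N))
    (β : HBeta) (Efl logz : B12.RunParams → ℕ → ℝ)
    (hEfl : ∀ (p : B12.RunParams) (j : ℕ), Efl p j = Real.log (normConstOfRecord F N χ β p j)
      - (Real.log (genSeq β p.g0 j) * (dimSU N : ℕ) * tstarCount (F.P p.K) j + ν.logσ₀ * tstarCount (F.P p.K) j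
        - logz p j * ((((F.P p.K).L : ℝ) ^ 4 - 1) * sitesCard (F.P p.K) (j + 1))))
    (p : B12.RunParams) :
    EOfRecord F N ν Efl logz (fun q => genSeq β q.g0) p = ENormOfRecord F N χ β p := by
  unfold EOfRecord ENormOfRecord
  refine Finset.sum_congr rfl fun j _ => ?_
  rw [eStepOfRecord, hEfl]
  ring

end Literature.MathematicalPhysics.QuantumFieldTheory.Balaban1983to89.Node00

end
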